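import Literature.IUT.LogThetaLattice.SplittingMonoidGenerators
import Literature.IUT.LogVolume.PilotTateParameter
import HarnessLib

/-!
# [IUTchIII] Definition 3.8 (i) over REAL objects: the Θ-pilot and q-pilot objects at the level of Tate
# parameters and arithmetic divisors (abc-iut cell, layer L6 ↔ Cor. 3.12 crew; sequel of `SplittingMonoidGenerators.lean`)

S. Mochizuki, *Inter-universal Teichmüller theory III*, kurims manuscript (May 2020), §3, Definition 3.8 (i),
p. 112 [claim: Mochizuki2012, status: disputed]: "the object of `Π_{j∈𝔽_l^⋇} (†𝓕⊛_MOD)_j` or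
`Π_{j∈𝔽_l^⋇} (†𝓕⊛_𝔪𝔬𝔡)_j` [cf. Example 3.6 …] — as well as its realification … — determined by any collection,
indexed by `v ∈ 𝕍^bad`, of generators up to torsion of the monoids `Ψ^⊥_{𝓕_lgp}(†𝓗𝓣)_v` … the **Θ-pilot
object**"; "the object of `†𝒞^⊩_△` determined by any collection, indexed by `v ∈ 𝕍^bad`, of generators up to
torsion of the splitting monoid associated to the split Frobenioid `†𝓕^⊢_{△,v}` — that is to say, at a more
concrete level, determined by the `q_v`, for `v ∈ 𝕍^bad` [cf. [IUTchI], Example 3.2, (iv)] … the **q-pilot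
object**". Over the generic instances `SplittingMonoids.ofProfiles` / `QPilotData.ofSplitting` of
`SplittingMonoidGenerators.lean`, this file works at the Dupuy–Hilado / Tate-parameter level of the Cor. 3.12
crew (abc-iut-c312-3 `Literature.IUT.LogVolume.PilotData`, `PilotDivisors.lean`, `PilotTateParameter.lean`;
T. Dupuy, A. Hilado, *The statement of Mochizuki's Corollary 3.12*, §3.2–3.3 [cite: DupuyHilado2025, §3.3]):
for pilot data `X = (F, j_E, S = 𝕍^bad, l)` and ANY family `τ_v ∈ F_vˣ` of Tate parameters at `v ∈ S`
(`‖τ_v‖ < 1`, `j(τ_v) = j_E`; such families EXIST, `exists_tateFamily`, by `PilotData.exists_tateParameter` =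
Silverman ATAEC V.5.1), ambient monoids `F_vˣ` (`v.adicCompletion F`), `ord_v` = `CompletionModel.ordv` (a
monoid homomorphism: `ordv_mul`, `ordvHom`; `ord_v(τ_v) = ord_v(q_v) = X.ordq v > 0`, `ordv_tate`):

* the q-pilot data **`QPilotData.dh X τ`** — splitting monoids `μ_{2l} · τ_v^ℕ ⊆ F_vˣ`, generators `τ_v`,
  object-forming map `qObjOf g := Σ_{v∈S} (ord_v(g_v)/2l)·[v]` (an `ℝ`-arithmetic divisor, c312-3's
  `FinDivisor`) — with **`qPilotObject (QPilotData.dh X τ) = X.qPilot`** (`qPilotObject_dh`; c312-3's q-pilot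
  divisor `P_q = Σ_v (ord_v(q_v)/2l)·[v]`, Dupuy–Hilado §3.3) and **`objOf g = X.qPilot` for EVERY collection
  `g` of generators up to torsion** (`objOf_dh_eq_qPilot`) — the printed "determined by ANY collection …"
  PROVED at the divisor level;
* the splitting monoids **`SplittingMonoids.dh X τ ζ`** — `μ_{2l}^{diag} · ξ_v^ℕ ⊆ ∏_j F_vˣ` for the value
  profile `ξ_v = tateProfile = (ζ_{v,j} · τ_v^{j²})_j` (abc-iut-L6-t2's `valueProfileOf`; ANY componentwise
  `2l`-torsion `ζ`), the Θ-side object-forming map `thetaObjOf X g := (Σ_{v∈S} (ord_v(g_{v,j})/2l)·[v])_j` (an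
  lgp-divisor), and **`thetaObjOf X g = X.thetaPilot` for EVERY collection of generators up to torsion**
  (`thetaObjOf_eq_thetaPilot`; c312-3's `P_Θ = (Σ_v (j²·ord_v(q_v)/2l)·[v])_j`) — whence, for any [IUTchIII]
  Prop. 3.7 output signature over these monoids whose object-forming algorithm `objOfLgp` factors through
  `thetaObjOf`, `thetaPilotObject = Φ(X.thetaPilot)` and the statement file's `thetaPilotObject_wellDefined`
  HOLDS (`thetaPilotObject_eq_of_factors`, `thetaPilotObject_wellDefined_of_factors`).

CONVENTION `q_v` vs `q̲_v = q_v^{1/2l}` (advisory A1 of abc-iut-L6-d3's pre-filing audit, abc-iut-c312-5's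
cross-check, cell finding R7-C5-F1/F1b): print generates the splitting monoids up to torsion by the `2l`-th
ROOT `q̲_v` of the Tate parameter ([IUTchI] Ex. 3.2 (iv)(v): `𝒪^× · q̲_v^ℕ`; [IUTchII] Cor. 3.5 (ii): values
`q̲_v^{j²}`), which need not exist in `F_v` for arbitrary pilot data (it does at the M level, [IUTchI] Def. 3.1
(b)(c)). THIS file is generated by the Tate parameter `τ_v = q_v` itself and carries the root as the
COEFFICIENT `1/2l` of the object-forming maps `qObjOf` / `thetaObjOf` — exactly as c312-3's `PilotData.qPilot` /
`thetaPilot` do (`ord_v(q̲_v^{j²}) = j²·ord_v(q_v)/2l`). Consequently (i) every DIVISOR-level statement here is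
the printed one; (ii) at the MONOID level `SplittingMonoids.dh` / `QPilotData.dh` are the `2l`-th-power
shadows `μ_{2l}·q_v^{j²ℕ} ⊆ μ_{2l}·q̲_v^{j²ℕ}` of the printed `Ψ^⊥_v` (abstractly isomorphic monoids, so the
generator-up-to-torsion statements transfer); (iii) the ROOT convention — explicit `2l`-th roots `ρ_v` with
`ρ_v^{2l} = τ_v` as arguments, object maps without the `1/2l` — is the companion `ThetaPilotObjectsRoot.lean`,
which also records the dictionary with this file and with abc-iut-c312-5's `Real.splittingMonoidLGP … qroot`
(Thm311RealTate, p408350). Honest framing: a MODEL-LEVEL bridge between landed typings (L6-t4 Def. 3.8 (i)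
interfaces, L6-t2 splitting monoids, c312-3 pilot divisors / Tate parameters); the Frobenioid-theoretic
Prop. 3.7 signature (`GlobalLGPFrobenioidSignature`) is NOT instantiated here, only its object-forming map is
modelled by arithmetic divisors (Dupuy–Hilado §3.3). Nothing here asserts a disputed claim or takes a side on
[IUTchIII] Cor. 3.12; typed ≠ discharged; instantiated ≠ endorsed.
-/

noncomputable section

namespace Literature.IUT.LogThetaLattice

open Literature.IUT.HodgeArakelov Literature.IUT.LogVolume NumberField IsDedekindDomain
open Literature.NumberTheory.EllipticCurves

universe u v w

/-! ### §3 The Dupuy–Hilado / Tate-parameter level: `ord_v`, the pilot divisors -/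

section Ordv

variable (F : Type) [Field F] [NumberField F] (v : HeightOneSpectrum (𝓞 F))

/-- `1 < Nm(v)` as a real number (size of the residue field). [folklore] -/
private theorem one_lt_absNorm_real : (1 : ℝ) < ((Ideal.absNorm v.asIdeal : ℕ) : ℝ) := by
  exact_mod_cast NumberField.HeightOneSpectrum.one_lt_absNorm v

/-- `ord_v` is multiplicative on `F_vˣ` (read off `‖y‖ = Nm(v)^{−ord_v(y)}`, `CompletionModel.norm_units`).
[cite: DupuyHilado2025, §2.4.2] -/
theorem ordv_mul (y z : (v.adicCompletion F)ˣ) :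
    CompletionModel.ordv F v (y * z) = CompletionModel.ordv F v y + CompletionModel.ordv F v z := by
  have hN := one_lt_absNorm_real F v
  have hN0 : (((Ideal.absNorm v.asIdeal : ℕ) : ℝ)) ≠ 0 := by positivity
  have h := CompletionModel.norm_units F v (y * z)
  rw [Units.val_mul, norm_mul, CompletionModel.norm_units F v y, CompletionModel.norm_units F v z,
    ← zpow_add₀ hN0] at h
  have := zpow_right_injective₀ (by positivity) hN.ne' h
  linarith

/-- `ord_v(1) = 0`. [cite: DupuyHilado2025, §2.4.2] -/
theorem ordv_one : CompletionModel.ordv F v 1 = 0 := by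
  have h := ordv_mul F v 1 1
  rw [mul_one] at h
  linarith

/-- `ord_v(y^n) = n · ord_v(y)`. [cite: DupuyHilado2025, §2.4.2] -/
theorem ordv_pow (y : (v.adicCompletion F)ˣ) (n : ℕ) :
    CompletionModel.ordv F v (y ^ n) = n * CompletionModel.ordv F v y := by
  induction n with
  | zero => simp [ordv_one]
  | succ n ih => rw [pow_succ, ordv_mul, ih]; push_cast; ring

/-- `ord_v : F_vˣ → ℤ` as a monoid homomorphism (values written multiplicatively).
[cite: DupuyHilado2025, §2.4.2] -/
def ordvHom : (v.adicCompletion F)ˣ →* Multiplicative ℤ where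
  toFun y := Multiplicative.ofAdd (CompletionModel.ordv F v y)
  map_one' := by rw [ordv_one]; rfl
  map_mul' y z := by rw [ordv_mul, ofAdd_add]

/-- `ordvHom` computes `ord_v`. [cite: DupuyHilado2025, §2.4.2] -/
@[simp] theorem toAdd_ordvHom (y : (v.adicCompletion F)ˣ) :
    Multiplicative.toAdd (ordvHom F v y) = CompletionModel.ordv F v y := rfl

/-- `ordvHom y = 1 ↔ ord_v(y) = 0`. [cite: DupuyHilado2025, §2.4.2] -/
theorem ordvHom_eq_one_iff (y : (v.adicCompletion F)ˣ) :
    ordvHom F v y = 1 ↔ CompletionModel.ordv F v y = 0 := by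
  constructor
  · intro h
    have := congrArg Multiplicative.toAdd h
    simpa using this
  · intro h
    apply Multiplicative.toAdd.injective
    simpa using h

/-- Torsion units have `ord_v = 0` (roots of unity are units of `𝒪_v`). [cite: DupuyHilado2025, §2.4.2] -/
theorem ordv_eq_zero_of_pow_eq_one {t : (v.adicCompletion F)ˣ} {k : ℕ} (hk : 0 < k) (ht : t ^ k = 1) :
    CompletionModel.ordv F v t = 0 := by
  have h := ordv_pow F v t k
  rw [ht, ordv_one] at h
  have hk' : (k : ℤ) ≠ 0 := by exact_mod_cast hk.ne'
  rcases mul_eq_zero.mp h.symm with h0 | h0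
  · exact absurd h0 hk'
  · exact h0

/-- `‖q‖ < 1 ⇒ ord_v(q) > 0`. [cite: DupuyHilado2025, §2.4.2] -/
theorem ordv_pos_of_norm_lt_one {q : (v.adicCompletion F)ˣ} (hq : ‖(q : v.adicCompletion F)‖ < 1) :
    0 < CompletionModel.ordv F v q := by
  have hN := one_lt_absNorm_real F v
  rw [CompletionModel.norm_units F v q] at hq
  have h : (((Ideal.absNorm v.asIdeal : ℕ) : ℝ)) ^ (-CompletionModel.ordv F v q) <
      (((Ideal.absNorm v.asIdeal : ℕ) : ℝ)) ^ (0 : ℤ) := by rwa [zpow_zero]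
  have := (zpow_lt_zpow_iff_right₀ hN).mp h
  omega

end Ordv

section DH

variable {F : Type} [Field F] [NumberField F] (X : PilotData F)

/-- **Tate families exist** (non-vacuity of the hypotheses used below): at every bad place `v ∈ S` of the
pilot data there is a Tate parameter `τ_v ∈ F_vˣ`, `‖τ_v‖ < 1`, `j(τ_v) = j_E` (abc-iut-c312-3's
`PilotData.exists_tateParameter`, Silverman ATAEC Lemma V.5.1). [cite: SilvermanATAEC1994, Lemma V.5.1] -/
theorem exists_tateFamily :
    ∃ τ : ∀ v ∈ X.S, (v.adicCompletion F)ˣ, ∀ v (hv : v ∈ X.S),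
      ‖(τ v hv : v.adicCompletion F)‖ < 1 ∧
        tateJ (τ v hv : v.adicCompletion F) = (X.jE : v.adicCompletion F) := by
  refine ⟨fun v hv => Units.mk0 (PilotData.exists_tateParameter F X hv).exists.choose
      (PilotData.exists_tateParameter F X hv).exists.choose_spec.1, fun v hv => ?_⟩
  exact (PilotData.exists_tateParameter F X hv).exists.choose_spec.2

variable (τ : ∀ v ∈ X.S, (v.adicCompletion F)ˣ)
  (hτ : ∀ v (hv : v ∈ X.S), ‖(τ v hv : v.adicCompletion F)‖ < 1 ∧
    tateJ (τ v hv : v.adicCompletion F) = (X.jE : v.adicCompletion F))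

include hτ in
/-- **`ord_v(τ_v) = ord_v(q_v)`**: the valuation of a Tate parameter at `v ∈ S` is the pilot data's `ordq v`
(`= −ord_v(j_E) > 0`; abc-iut-c312-3's `PilotData.ordq_eq_ordv`). [cite: DupuyHilado2025, §3.2] -/
theorem ordv_tate (v : HeightOneSpectrum (𝓞 F)) (hv : v ∈ X.S) :
    CompletionModel.ordv F v (τ v hv) = X.ordq v :=
  (PilotData.ordq_eq_ordv F v X (τ v hv) (hτ v hv).1 (hτ v hv).2).symm

include hτ in
/-- The valuation does not kill a Tate parameter: `ordvHom τ_v ≠ 1` (`ord_v(τ_v) = ord_v(q_v) > 0`).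
[cite: DupuyHilado2025, §3.2] -/
theorem ordvHom_tate_ne_one (v : HeightOneSpectrum (𝓞 F)) (hv : v ∈ X.S) : ordvHom F v (τ v hv) ≠ 1 := by
  rw [Ne, ordvHom_eq_one_iff, ordv_tate X τ hτ v hv]
  exact (X.ordq_pos hv).ne'

/-- `0 < 2l` for pilot data. [cite: DupuyHilado2025, §3.3] -/
theorem twoL_pos : 0 < 2 * X.l := by
  have := X.l_prime.pos
  omega

/-- **The q-side object-forming map at the Dupuy–Hilado level**: a collection `(g_v)_{v ∈ S}`, `g_v ∈ F_vˣ`,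
determines the ℝ-arithmetic divisor `Σ_{v ∈ S} (ord_v(g_v)/2l)·[v]` — the object of `†𝒞^⊩_△` it determines
read as an arithmetic divisor (Dupuy–Hilado §3.3 `P_q = Σ_v ord_v(q̲_v)[v]`, `q̲_v = q_v^{1/2l}`: the `2l`-th
root of [IUTchI] Ex. 3.2 (iv) is carried by the coefficient `1/2l`, as in c312-3's `PilotData.qPilot`).
[cite: DupuyHilado2025, §3.3] -/
def qObjOf (g : ∀ v ∈ X.S, (v.adicCompletion F)ˣ) : FinDivisor F :=
  ∑ v ∈ X.S.attach, FinDivisor.of v.1 ((CompletionModel.ordv F v.1 (g v.1 v.2) : ℝ) / (2 * X.l))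

/-- **The Θ-side object-forming map at the Dupuy–Hilado level**: a collection `(g_{v,j})_{v ∈ S, j ∈ 𝔽_l^⋇}`
determines the lgp-divisor `(Σ_{v ∈ S} (ord_v(g_{v,j})/2l)·[v])_j` — the Prop. 3.7 (v) "object … from the
local fractional ideals generated by elements of the monoids `Ψ_{𝓕_lgp}(†𝓗𝓣)_v` for `v ∈ 𝕍^bad`" read as an
lgp-divisor (Dupuy–Hilado §3.3 `P_{Θ,j} = Σ_v ord_v(q̲_v^{j²})[v]`, c312-3's `PilotData.thetaPilot`).
[cite: DupuyHilado2025, §3.3] -/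
def thetaObjOf (g : ∀ v ∈ X.S, Fin X.lstar → (v.adicCompletion F)ˣ) : LgpDivisor F X.lstar :=
  fun i => ∑ v ∈ X.S.attach,
    FinDivisor.of v.1 ((CompletionModel.ordv F v.1 (g v.1 v.2 i) : ℝ) / (2 * X.l))

/-- Re-indexing: a sum over `S.attach` of single-place divisors whose coefficients do not depend on the
membership proof is the corresponding sum over `S`. [folklore] -/
private theorem sum_attach_of_eq {c : ∀ v ∈ X.S, ℝ} {d : HeightOneSpectrum (𝓞 F) → ℝ}
    (h : ∀ v (hv : v ∈ X.S), c v hv = d v) :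
    ∑ v ∈ X.S.attach, FinDivisor.of v.1 (c v.1 v.2) = ∑ v ∈ X.S, FinDivisor.of v (d v) := by
  rw [← Finset.sum_attach X.S (fun v => FinDivisor.of v (d v))]
  exact Finset.sum_congr rfl fun v _ => by rw [h v.1 v.2]

/-- **The q-pilot data of Definition 3.8 (i) at the Dupuy–Hilado level**: ambient monoids `F_vˣ`, splitting
monoids `μ_{2l} · τ_v^ℕ` (abc-iut-L6-t2's `splittingMonoidAt F_vˣ 2l τ_v 1`), distinguished generators the Tate
parameters `τ_v`, object-forming map `qObjOf`. [claim: Mochizuki2012, status: disputed] -/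
def QPilotData.dh :
    QPilotData (FinDivisor F)
      (fun v (h : v ∈ X.S) => ↥(splittingMonoidAt ((v.adicCompletion F)ˣ) (2 * X.l) (τ v h) 1)) :=
  QPilotData.ofSplitting (V := HeightOneSpectrum (𝓞 F)) (isBad := (· ∈ X.S))
    (fun v (_ : v ∈ X.S) => (v.adicCompletion F)ˣ) (2 * X.l) (twoL_pos X) τ
    (fun g => qObjOf X fun v h => (g v h : (v.adicCompletion F)ˣ))

include hτ in
/-- **`qPilotObject = P_q`**: the q-pilot object of Definition 3.8 (i) for the data `QPilotData.dh X τ` IS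
abc-iut-c312-3's q-pilot divisor `X.qPilot = Σ_{v ∈ S} (ord_v(q_v)/2l)·[v]` (Dupuy–Hilado §3.3).
[claim: Mochizuki2012, status: disputed] -/
theorem qPilotObject_dh : qPilotObject (QPilotData.dh X τ) = X.qPilot := by
  show qObjOf X (fun v h => τ v h) = X.qPilot
  unfold qObjOf PilotData.qPilot
  exact sum_attach_of_eq X (c := fun v hv => (CompletionModel.ordv F v (τ v hv) : ℝ) / (2 * X.l))
    (d := fun v => (X.ordq v : ℝ) / (2 * X.l)) fun v hv => by rw [ordv_tate X τ hτ v hv]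

include hτ in
/-- **"determined by ANY collection … of generators up to torsion"** ([IUTchIII] Def. 3.8 (i) p. 112), PROVED at
the model: for EVERY collection `g = (g_v)_{v ∈ S}` of generators up to torsion of the splitting monoids
`μ_{2l} · τ_v^ℕ`, the object formed is the same q-pilot divisor `X.qPilot` (each `g_v = ζ_v · τ_v` with
`ζ_v^{2l} = 1`, `ord_v(ζ_v) = 0`). [claim: Mochizuki2012, status: disputed] -/
theorem objOf_dh_eq_qPilot
    (g : ∀ v (h : v ∈ X.S), ↥(splittingMonoidAt ((v.adicCompletion F)ˣ) (2 * X.l) (τ v h) 1))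
    (hg : ∀ v h, IsGeneratorUpToTorsion (g v h)) : (QPilotData.dh X τ).objOf g = X.qPilot := by
  show qObjOf X (fun v h => (g v h : (v.adicCompletion F)ˣ)) = X.qPilot
  unfold qObjOf PilotData.qPilot
  refine sum_attach_of_eq X
    (c := fun v hv => (CompletionModel.ordv F v (g v hv : (v.adicCompletion F)ˣ) : ℝ) / (2 * X.l))
    (d := fun v => (X.ordq v : ℝ) / (2 * X.l)) fun v hv => ?_
  obtain ⟨ζ, hζ, hgv⟩ := exists_eq_root_mul_of_isGeneratorUpToTorsion (ordvHom F v) (twoL_pos X)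
    (ordvHom_tate_ne_one X τ hτ v hv) (hg v hv)
  have hζ0 : CompletionModel.ordv F v (ζ : (v.adicCompletion F)ˣ) = 0 :=
    ordv_eq_zero_of_pow_eq_one F v (twoL_pos X) ((mem_rootsOfUnity' _ ζ).mp hζ)
  rw [hgv, ordv_mul, hζ0, zero_add, one_pow, pow_one, ordv_tate X τ hτ v hv]

variable (ζ : ∀ v ∈ X.S, Fin X.lstar → ((v.adicCompletion F)ˣ)ˣ)
  (hζ : ∀ v (hv : v ∈ X.S) (i : Fin X.lstar), ζ v hv i ∈ rootsOfUnity (2 * X.l) ((v.adicCompletion F)ˣ))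

/-- **The value-profile of the Tate parameter** `ξ_v = (ζ_{v,j} · τ_v^{j²})_{j ∈ 𝔽_l^⋇}` (abc-iut-L6-t2's
`valueProfileOf τ_v (j ↦ j²) ζ_v`; [IUTchII] Rmk. 2.5.1 (i) "`q_v^{j²}`", componentwise torsion `ζ_v` of Cor.
3.5 (ii)), the label `j = i + 1` of `i : Fin l⋇` being `labelNat i`. [claim: Mochizuki2012, status: disputed] -/
def tateProfile (v : HeightOneSpectrum (𝓞 F)) (hv : v ∈ X.S) : Fin X.lstar → (v.adicCompletion F)ˣ :=
  valueProfileOf (τ v hv) (fun i => labelNat i ^ 2) (ζ v hv)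

/-- Components of the Tate value-profile: `ξ_{v,i} = ζ_{v,i} · τ_v^{(i+1)²}`. [claim: Mochizuki2012, status: disputed] -/
@[simp] theorem tateProfile_apply (v : HeightOneSpectrum (𝓞 F)) (hv : v ∈ X.S) (i : Fin X.lstar) :
    tateProfile X τ ζ v hv i = (ζ v hv i : (v.adicCompletion F)ˣ) * τ v hv ^ labelNat i ^ 2 :=
  rfl

/-- **The splitting monoids `Ψ^⊥_{𝓕_lgp,v}` of Definition 3.8 (i) at the Dupuy–Hilado level**: at each `v ∈ S`,
inside `∏_{j ∈ 𝔽_l^⋇} F_vˣ`, abc-iut-L6-t2's `μ_{2l}^{diag} · ξ_v^ℕ` for the Tate value-profile `ξ_v`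
([IUTchIII] Prop. 3.5 (ii)(c); [IUTchII] Cor. 3.5 (iii)). [claim: Mochizuki2012, status: disputed] -/
def SplittingMonoids.dh :
    SplittingMonoids (fun v (_ : v ∈ X.S) => Fin X.lstar → (v.adicCompletion F)ˣ) :=
  SplittingMonoids.ofProfiles (V := HeightOneSpectrum (𝓞 F)) (isBad := (· ∈ X.S))
    (fun v (_ : v ∈ X.S) => (v.adicCompletion F)ˣ) (2 * X.l) (twoL_pos X) (tateProfile X τ ζ)

include hτ hζ in
/-- `ord_v` of the components of the Tate value-profile: `ord_v(ξ_{v,i}) = (i+1)² · ord_v(q_v)`.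
[cite: DupuyHilado2025, §3.3] -/
theorem ordv_tateProfile (v : HeightOneSpectrum (𝓞 F)) (hv : v ∈ X.S) (i : Fin X.lstar) :
    CompletionModel.ordv F v (tateProfile X τ ζ v hv i) = (labelNat i ^ 2 : ℕ) * X.ordq v := by
  have hζ0 : CompletionModel.ordv F v (ζ v hv i : (v.adicCompletion F)ˣ) = 0 :=
    ordv_eq_zero_of_pow_eq_one F v (twoL_pos X) ((mem_rootsOfUnity' _ _).mp (hζ v hv i))
  rw [tateProfile_apply, ordv_mul, hζ0, zero_add, ordv_pow, ordv_tate X τ hτ v hv]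

include hτ hζ in
/-- **"determined by ANY collection … of generators up to torsion"** ([IUTchIII] Def. 3.8 (i) p. 112), Θ-side,
PROVED at the model: for EVERY collection `g = (g_v)_{v ∈ S}` of generators up to torsion of the splitting
monoids `μ_{2l}^{diag} · ξ_v^ℕ`, the lgp-divisor formed is abc-iut-c312-3's theta-pilot divisor
`X.thetaPilot = (Σ_v ((j²·ord_v(q_v))/2l)·[v])_j` (Dupuy–Hilado §3.3 `P_Θ`) — independently of `g` and of the
componentwise torsion `ζ` of the profile. [claim: Mochizuki2012, status: disputed] -/
theorem thetaObjOf_eq_thetaPilot (g : ∀ v (h : v ∈ X.S), ↥((SplittingMonoids.dh X τ ζ).Msplit v h))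
    (hg : ∀ v h, IsGeneratorUpToTorsion (g v h)) :
    thetaObjOf X (fun v h => (g v h : Fin X.lstar → (v.adicCompletion F)ˣ)) = X.thetaPilot := by
  funext i
  unfold thetaObjOf PilotData.thetaPilot
  refine sum_attach_of_eq X
    (c := fun v hv =>
      (CompletionModel.ordv F v ((g v hv : Fin X.lstar → (v.adicCompletion F)ˣ) i) : ℝ) / (2 * X.l))
    (d := fun v => (((i : ℕ) + 1 : ℝ) ^ 2) * (X.ordq v : ℝ) / (2 * X.l)) fun v hv => ?_
  have hl : 0 < X.lstar := lt_of_lt_of_le (by norm_num) X.two_le_lstar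
  have hne : ordvHom F v (tateProfile X τ ζ v hv ⟨0, hl⟩) ≠ 1 := by
    rw [Ne, ordvHom_eq_one_iff, ordv_tateProfile X τ hτ ζ hζ v hv]
    have := X.ordq_pos hv
    simp only [labelNat]
    positivity
  obtain ⟨ω, hω, hgv⟩ := exists_eq_diag_mul_of_isGeneratorUpToTorsion (ordvHom F v) (twoL_pos X)
    (ξ := tateProfile X τ ζ v hv) ⟨0, hl⟩ hne (g := g v hv) (hg v hv)
  have hω0 : CompletionModel.ordv F v (ω : (v.adicCompletion F)ˣ) = 0 :=
    ordv_eq_zero_of_pow_eq_one F v (twoL_pos X) ((mem_rootsOfUnity' _ ω).mp hω)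
  have hcomp : (g v hv : Fin X.lstar → (v.adicCompletion F)ˣ) i =
      (ω : (v.adicCompletion F)ˣ) * tateProfile X τ ζ v hv i := by
    rw [show (g v hv : Fin X.lstar → (v.adicCompletion F)ˣ) = _ from hgv]
  rw [hcomp, ordv_mul, hω0, zero_add, ordv_tateProfile X τ hτ ζ hζ v hv i]
  simp only [labelNat]
  push_cast
  ring

/-! #### Consequences for the Θ-pilot object of a Prop. 3.7 signature over these monoids -/

variable {Frd : Type u} {IsoF : Frd → Frd → Type} {Ob : Frd → Type} {realify : Frd → Frd}
  {Strip : Type u} {IsoS : Strip → Strip → Type}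
  (S : GlobalLGPFrobenioidSignature X.lstar (HeightOneSpectrum (𝓞 F)) (· ∈ X.S) Frd IsoF Ob realify
    Strip IsoS (fun v (_ : v ∈ X.S) => Fin X.lstar → (v.adicCompletion F)ˣ))
  (Φ : LgpDivisor F X.lstar → Ob S.Clgp) (hΦ : ∀ g, S.objOfLgp g = Φ (thetaObjOf X g))

include hτ hζ hΦ in
/-- **The Θ-pilot object is (the image of) `P_Θ`**: for any [IUTchIII] Prop. 3.7 output signature over the
monoids `∏_j F_vˣ` whose object-forming algorithm `objOfLgp` (Prop. 3.7 (v)) factors through the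
lgp-divisor map `thetaObjOf` — i.e. reads the local fractional ideals generated by the `g_{v,j}` — the Θ-pilot
object of Definition 3.8 (i) for the splitting monoids `SplittingMonoids.dh X τ ζ` is `Φ(X.thetaPilot)`.
[claim: Mochizuki2012, status: disputed] -/
theorem thetaPilotObject_eq_of_factors :
    thetaPilotObject S (SplittingMonoids.dh X τ ζ) = Φ X.thetaPilot := by
  unfold thetaPilotObject
  rw [hΦ, thetaObjOf_eq_thetaPilot X τ hτ ζ hζ]
  exact fun v h => Classical.choose_spec ((SplittingMonoids.dh X τ ζ).exists_gen v h)

include hτ hζ hΦ in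
/-- **`thetaPilotObject_wellDefined` HOLDS at the model** ([IUTchIII] Def. 3.8 (i) p. 112 "determined by any
collection … of generators up to torsion"): under the same factorisation, the object-forming algorithm takes
the same value on any two collections of generators up to torsion of the splitting monoids
`SplittingMonoids.dh X τ ζ`. [claim: Mochizuki2012, status: disputed] -/
theorem thetaPilotObject_wellDefined_of_factors :
    thetaPilotObject_wellDefined S (SplittingMonoids.dh X τ ζ) := by
  intro g g' hg hg'
  rw [hΦ, hΦ, thetaObjOf_eq_thetaPilot X τ hτ ζ hζ g hg, thetaObjOf_eq_thetaPilot X τ hτ ζ hζ g' hg']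

end DH

end Literature.IUT.LogThetaLattice
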